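import Summits.CriticalPhenomena.PercolationContinuityZ3.Theorems.PercNearOneGluingNoHeavyConstsSourceLocalFourEvents
import HarnessLib

/-!
# The cross-conditioning exchange inequalities (F1), (F1_U) of the CROSS member at `u = z` — PROVED
# (PAPER-2 track (ii): constants of the CSH family; seat `prim-consts-2`, gen 19)

builds on p205010 (kernel theorem, internal audit signed; external expert review pending).  Support file
(`--supports stmt-CriticalPhenomena-4575`); memo `run/shared/lean/prim/consts/FROM-prim-consts-2-g19-RIDER-EXCHANGE.md`.
Theorems only; no sorries; standard axioms.

Notation of the MDL(X)′ programme (`Consts.MDLXJoint`): owner `s`, avoided set `X`, markers `y`, `z`; `D = {s ↮ X}`,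
`T = {y ↮ {s} ∪ X} ∩ D`, `W = {y ↔ z}`, `Z = {s ↔ z}`, `Y = {s ↔ y}`, `T' = T(X ∪ {z}) ∩ {y ↮ z} = {y ↮ {s,z} ∪ X, s ↮ X ∪ {z}}`.
The CROSS member `M₂` at `u = z` (memo FROM-prim-consts-2-g18-XEDGE-CROSS.md addendum (8)) is
`μ(T')·cov_D(F;Z) − μ(T∩W)·cov_{D∖Z}(F;Y)`; at an up-set indicator `F = 1_U` its F-free part and its up-set-rider part are
the "exchange" inequalities
  (F1)   `μ(T') · μ(D ∩ Z) ≥ μ(T ∩ W) · μ(D ∖ Z ∩ Y)`,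
  (F1_U) `μ(T') · μ(D ∩ Z ∩ U) ≥ μ(T ∩ W) · μ(D ∖ Z ∩ Y ∩ U)`   for every increasing event `U` of the cluster of `s`
(0 violations in the seat's exact census, addendum (11)).  They are NOT same-conditioning exchanges: the two left factors live
in `{y ↮ s}` and `{s ↔ y}`.  Both are instances of the tree's `Consts.localEv_fourEvents` (Ahlswede–Daykin four events under
avoidance conditioning, van den Berg–Häggström–Kahn's induction for source-local events) with the source set `{s, y}` in
both factors: a configuration of `{y↔z, y↮s}` and one of `{s↔y, s↮z}` MEET in `{y↮s, y↮z, s↮z}` and JOIN in `{s↔y↔z}`, and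
the avoidances `{s,y} ↮ X` (first factor), `{s,y} ↮ Y ∪ {z}`… are carried by the induction: union on the meet side,
intersection on the join side.  Proved here in the two-set form (sets `X` in the first and `Y` in the second factor):
* `Consts.crossExchange`:
  `μ(y↔z, y↮s, y↮X, s↮X) · μ(s↔y, s↮z, s↮Y) ≤ μ(y↮s, y↮z, s↮z, y↮X∪Y, s↮X∪Y) · μ(s↔y, s↔z, s↮X∩Y)`;
* `Consts.crossExchange_upset`: the same with `{V(C_s) ∈ 𝒰}` (`𝒰` a monotone family of vertex sets) on the second and
  fourth factor.
(F1) is the case `X = Y`, `𝒰 = ⊤` (and `μ(s↔y, s↔z, s↮X) ≤ μ(D ∩ Z)`).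
[cite: VandenbergHaggstromKahn2005, Thm. 1.1 and its proof (pp. 3–5)] [cite: BollobasRiordan2006, Ch. 2 Thm. 7 and eq. (14)]
-/

noncomputable section

namespace Summit.CriticalPhenomena.PercolationContinuityZ3.Theorems

open MeasureTheory Finset
open Literature.Probability.LatticeModels (prodBernoulli)
open Literature.Probability.Percolation

namespace Consts

variable {V : Type} [DecidableEq V] [Fintype V] (w : Sym2 V → unitInterval)

omit [DecidableEq V] [Fintype V] in
/-- Reachability in the open graph is monotone in the configuration. [folklore] -/
private theorem reach_mono {ω ω' : BondConfig V} (h : ω ⊆ ω') {u v : V} (huv : (openGraph ω).Reachable u v) :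
    (openGraph ω').Reachable u v :=
  huv.mono (BHK2006.openGraph_le h)

omit [DecidableEq V] [Fintype V] in
/-- The reach profile at a source. [folklore] -/
private theorem reachOf_apply {S : Finset V} {ω : BondConfig V} {v : V} (hv : v ∈ S) :
    reachOf S ω v = {u | (openGraph ω).Reachable v u} := by
  ext u; exact ⟨fun h => h.2, fun h => ⟨hv, h⟩⟩

/-- **THEOREM (cross-conditioning exchange with an up-set rider, (F1_U) two-set form).**  For `μ = prodBernoulli w`, vertices
`s, y, z`, vertex sets `X, Y` and a monotone family `𝒰` of vertex sets (an increasing event `{V(C_s) ∈ 𝒰}` of the cluster of `s`):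
`μ(y↔z, y↮s, y↮X, s↮X) · μ(s↔y, s↮z, s↮Y, V(C_s)∈𝒰) ≤ μ(y↮s, y↮z, s↮z, y↮X∪Y, s↮X∪Y) · μ(s↔y, s↔z, s↮X∩Y, V(C_s)∈𝒰)`.
[cite: VandenbergHaggstromKahn2005, Thm. 1.1 and its proof (pp. 3–5) — instance of `Consts.localEv_fourEvents`, derived here] -/
theorem crossExchange_upset (s y z : V) (X Y : Set V) {𝒰 : Set V → Prop} (h𝒰 : Monotone 𝒰) :
    (prodBernoulli w).real {ω : BondConfig V | (openGraph ω).Reachable y z ∧ ¬ (openGraph ω).Reachable y s ∧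
        (∀ x ∈ X, ¬ (openGraph ω).Reachable y x) ∧ (∀ x ∈ X, ¬ (openGraph ω).Reachable s x)} *
      (prodBernoulli w).real {ω : BondConfig V | (openGraph ω).Reachable s y ∧ ¬ (openGraph ω).Reachable s z ∧
        (∀ x ∈ Y, ¬ (openGraph ω).Reachable s x) ∧ 𝒰 {v | (openGraph ω).Reachable s v}} ≤
    (prodBernoulli w).real {ω : BondConfig V | ¬ (openGraph ω).Reachable y s ∧ ¬ (openGraph ω).Reachable y z ∧
        ¬ (openGraph ω).Reachable s z ∧ (∀ x ∈ X ∪ Y, ¬ (openGraph ω).Reachable y x) ∧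
        (∀ x ∈ X ∪ Y, ¬ (openGraph ω).Reachable s x)} *
      (prodBernoulli w).real {ω : BondConfig V | (openGraph ω).Reachable s y ∧ (openGraph ω).Reachable s z ∧
        (∀ x ∈ X ∩ Y, ¬ (openGraph ω).Reachable s x) ∧ 𝒰 {v | (openGraph ω).Reachable s v}} := by
  -- the four predicates on reach profiles of the source set `{s, y}`
  set S : Finset V := {s, y} with hSdef
  have hsS : s ∈ S := by simp [hSdef]
  have hyS : y ∈ S := by simp [hSdef]
  have hRs : ∀ ω : BondConfig V, reachOf S ω s = {v | (openGraph ω).Reachable s v} := fun ω => reachOf_apply hsS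
  have hRy : ∀ ω : BondConfig V, reachOf S ω y = {v | (openGraph ω).Reachable y v} := fun ω => reachOf_apply hyS
  have hball : ∀ (P : V → Prop), (∀ s' ∈ S, P s') ↔ (P s ∧ P y) := fun P => by
    simp only [hSdef, Finset.mem_insert, Finset.mem_singleton, forall_eq_or_imp, forall_eq]
  let Φ₁ : (V → Set V) → Prop := fun R => z ∈ R y ∧ s ∉ R y
  let Φ₂ : (V → Set V) → Prop := fun R => y ∈ R s ∧ z ∉ R s ∧ 𝒰 (R s)
  let Φ₃ : (V → Set V) → Prop := fun R => s ∉ R y ∧ z ∉ R y ∧ z ∉ R s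
  let Φ₄ : (V → Set V) → Prop := fun R => y ∈ R s ∧ z ∈ R s ∧ 𝒰 (R s)
  have hAD : ∀ ω ω' : BondConfig V, Φ₁ (reachOf S ω) → Φ₂ (reachOf S ω') →
      Φ₃ (reachOf (S ∩ S) (ω ∩ ω')) ∧ Φ₄ (reachOf (S ∪ S) (ω ∪ ω')) := by
    intro ω ω' h1 h2
    simp only [Φ₁, Φ₂, Φ₃, Φ₄, Finset.inter_self, Finset.union_self, hRs, hRy, Set.mem_setOf_eq] at h1 h2 ⊢
    obtain ⟨hyz, hys⟩ := h1
    obtain ⟨hsy, hsz, hU⟩ := h2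
    exact ⟨⟨fun h => hys (reach_mono Set.inter_subset_left h),
      fun h => hsz (hsy.trans (reach_mono Set.inter_subset_right h)),
      fun h => hsz (reach_mono Set.inter_subset_right h)⟩,
      reach_mono Set.subset_union_right hsy,
      (reach_mono Set.subset_union_right hsy).trans (reach_mono Set.subset_union_left hyz),
      h𝒰 (fun v (hv : (openGraph ω').Reachable s v) => reach_mono Set.subset_union_right hv) hU⟩
  have key := localEv_fourEvents w S S hAD X Y
  rw [Finset.inter_self, Finset.union_self] at key
  -- identify the four events
  have e1 : ({ω : BondConfig V | Φ₁ (reachOf S ω)} ∩ {ω | ∀ s' ∈ S, ∀ x ∈ X, ω ∉ openConn s' x}) =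
      {ω : BondConfig V | (openGraph ω).Reachable y z ∧ ¬ (openGraph ω).Reachable y s ∧
        (∀ x ∈ X, ¬ (openGraph ω).Reachable y x) ∧ (∀ x ∈ X, ¬ (openGraph ω).Reachable s x)} := by
    ext ω
    simp only [Φ₁, Set.mem_inter_iff, Set.mem_setOf_eq, hRy, hball, openConn]
    tauto
  have e2 : ({ω : BondConfig V | Φ₂ (reachOf S ω)} ∩ {ω | ∀ s' ∈ S, ∀ x ∈ Y, ω ∉ openConn s' x}) =
      {ω : BondConfig V | (openGraph ω).Reachable s y ∧ ¬ (openGraph ω).Reachable s z ∧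
        (∀ x ∈ Y, ¬ (openGraph ω).Reachable s x) ∧ 𝒰 {v | (openGraph ω).Reachable s v}} := by
    ext ω
    simp only [Φ₂, Set.mem_inter_iff, Set.mem_setOf_eq, hRs, hball, openConn]
    constructor
    · rintro ⟨⟨hsy, hsz, hU⟩, hsY, -⟩
      exact ⟨hsy, hsz, hsY, hU⟩
    · rintro ⟨hsy, hsz, hsY, hU⟩
      exact ⟨⟨hsy, hsz, hU⟩, hsY, fun x hx h' => hsY x hx (hsy.trans h')⟩
  have e3 : ({ω : BondConfig V | Φ₃ (reachOf S ω)} ∩ {ω | ∀ s' ∈ S, ∀ x ∈ X ∪ Y, ω ∉ openConn s' x}) =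
      {ω : BondConfig V | ¬ (openGraph ω).Reachable y s ∧ ¬ (openGraph ω).Reachable y z ∧
        ¬ (openGraph ω).Reachable s z ∧ (∀ x ∈ X ∪ Y, ¬ (openGraph ω).Reachable y x) ∧
        (∀ x ∈ X ∪ Y, ¬ (openGraph ω).Reachable s x)} := by
    ext ω
    simp only [Φ₃, Set.mem_inter_iff, Set.mem_setOf_eq, hRs, hRy, hball, openConn]
    tauto
  have e4 : ({ω : BondConfig V | Φ₄ (reachOf S ω)} ∩ {ω | ∀ s' ∈ S, ∀ x ∈ X ∩ Y, ω ∉ openConn s' x}) =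
      {ω : BondConfig V | (openGraph ω).Reachable s y ∧ (openGraph ω).Reachable s z ∧
        (∀ x ∈ X ∩ Y, ¬ (openGraph ω).Reachable s x) ∧ 𝒰 {v | (openGraph ω).Reachable s v}} := by
    ext ω
    simp only [Φ₄, Set.mem_inter_iff, Set.mem_setOf_eq, hRs, hball, openConn]
    constructor
    · rintro ⟨⟨hsy, hsz, hU⟩, hsXY, -⟩
      exact ⟨hsy, hsz, hsXY, hU⟩
    · rintro ⟨hsy, hsz, hsXY, hU⟩
      exact ⟨⟨hsy, hsz, hU⟩, hsXY, fun x hx h' => hsXY x hx (hsy.trans h')⟩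
  rw [e1, e2, e3, e4] at key
  exact key

/-- **THEOREM (cross-conditioning exchange (F1), two-set form).**  For `μ = prodBernoulli w`, vertices `s, y, z` and vertex
sets `X, Y`:
`μ(y↔z, y↮s, y↮X, s↮X) · μ(s↔y, s↮z, s↮Y) ≤ μ(y↮s, y↮z, s↮z, y↮X∪Y, s↮X∪Y) · μ(s↔y, s↔z, s↮X∩Y)`.
At `X = Y` this is (F1) `μ(T∩W)·μ(D∖Z∩Y) ≤ μ(T')·μ(D∩Z∩Y) ≤ μ(T')·μ(D∩Z)` of the MDL(X)′ programme.
[cite: VandenbergHaggstromKahn2005, Thm. 1.1 and its proof (pp. 3–5) — instance of `Consts.localEv_fourEvents`, derived here] -/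
theorem crossExchange (s y z : V) (X Y : Set V) :
    (prodBernoulli w).real {ω : BondConfig V | (openGraph ω).Reachable y z ∧ ¬ (openGraph ω).Reachable y s ∧
        (∀ x ∈ X, ¬ (openGraph ω).Reachable y x) ∧ (∀ x ∈ X, ¬ (openGraph ω).Reachable s x)} *
      (prodBernoulli w).real {ω : BondConfig V | (openGraph ω).Reachable s y ∧ ¬ (openGraph ω).Reachable s z ∧
        (∀ x ∈ Y, ¬ (openGraph ω).Reachable s x)} ≤
    (prodBernoulli w).real {ω : BondConfig V | ¬ (openGraph ω).Reachable y s ∧ ¬ (openGraph ω).Reachable y z ∧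
        ¬ (openGraph ω).Reachable s z ∧ (∀ x ∈ X ∪ Y, ¬ (openGraph ω).Reachable y x) ∧
        (∀ x ∈ X ∪ Y, ¬ (openGraph ω).Reachable s x)} *
      (prodBernoulli w).real {ω : BondConfig V | (openGraph ω).Reachable s y ∧ (openGraph ω).Reachable s z ∧
        (∀ x ∈ X ∩ Y, ¬ (openGraph ω).Reachable s x)} := by
  have key := crossExchange_upset w s y z X Y (𝒰 := fun _ => True) (fun _ _ _ _ => trivial)
  simpa only [and_true] using key

/-- **COROLLARY ((F1) of the MDL(X)′ programme, one avoided set).**  With `D = {s↮X}`, `Z = {s↔z}`, `Y = {s↔y}`,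
`T∩W = {y↔z, y↮{s}∪X, s↮X}`, `T' = {y↮{s,z}∪X, s↮X∪{z}}`:  `μ(T∩W) · μ(D ∖ Z ∩ Y) ≤ μ(T') · μ(D ∩ Z)`.
[cite: VandenbergHaggstromKahn2005, Thm. 1.1 and its proof (pp. 3–5) — corollary, derived here] -/
theorem crossExchange_F1 (s y z : V) (X : Set V) :
    (prodBernoulli w).real {ω : BondConfig V | (openGraph ω).Reachable y z ∧ ¬ (openGraph ω).Reachable y s ∧
        (∀ x ∈ X, ¬ (openGraph ω).Reachable y x) ∧ (∀ x ∈ X, ¬ (openGraph ω).Reachable s x)} *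
      (prodBernoulli w).real {ω : BondConfig V | (openGraph ω).Reachable s y ∧ ¬ (openGraph ω).Reachable s z ∧
        (∀ x ∈ X, ¬ (openGraph ω).Reachable s x)} ≤
    (prodBernoulli w).real {ω : BondConfig V | ¬ (openGraph ω).Reachable y s ∧ ¬ (openGraph ω).Reachable y z ∧
        ¬ (openGraph ω).Reachable s z ∧ (∀ x ∈ X, ¬ (openGraph ω).Reachable y x) ∧
        (∀ x ∈ X, ¬ (openGraph ω).Reachable s x)} *
      (prodBernoulli w).real {ω : BondConfig V | (openGraph ω).Reachable s z ∧ (∀ x ∈ X, ¬ (openGraph ω).Reachable s x)} := by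
  have key := crossExchange w s y z X X
  simp only [Set.union_self, Set.inter_self] at key
  refine key.trans (mul_le_mul_of_nonneg_left (measureReal_mono fun ω hω => ?_) measureReal_nonneg)
  exact ⟨hω.2.1, hω.2.2⟩

end Consts

end Summit.CriticalPhenomena.PercolationContinuityZ3.Theorems

end
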